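import Mathlib

/-!
# SoloBlindTwistorInvariance — an endomorphism that is scalar on `W` and preserves a complement commutes with every "rotation of `W`"

solo-HodgeConjecture-blind, session s19 (`paper/k3-weil-faces.md` §2.6, Lemma 2.6.1, the direction used by
door H).

Setting of the application: `H = H²(X, ℝ)` of a K3 surface with its intersection form, `W ⊂ H` the positive
3-plane `⟨Re σ, Im σ, κ⟩` of a hyperkähler structure, `SO(W)` acting on `H` by rotations of `W` extended by the
identity on `Wᗮ` (this is how the unit quaternions act on `H²` along the twistor line), and `Ψ` a self-adjoint
endomorphism with `Ψ|_W = c · id` (e.g. `Ψ = ψ ⊕ ν`, `ψ` real multiplication by `√d` on `T(X)`, `W` inside the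
`√d`-eigenspace).  Conclusion: `Ψ` commutes with `SO(W)`, i.e. the class `Ψ ∈ H² ⊗ H²` is `SU(2)`-invariant and
stays of Hodge type `(2,2)` on `X × X` along the whole twistor line.  The same two-line computation shows that a
SIMILARITY `ψ : H₁ → H₂` (`⟪ψ x, ψ y⟫ = d ⟪x, y⟫`) with `ψ W₁ = W₂` intertwines `SO(W₁)` and `SO(W₂)`, which is
the only property of `ψ` used by Markman's diagonal twistor lines (arXiv:2204.00516, §5.3 and Lemma 5.12) —
there stated for isometries.

We formalise the linear algebra: (A) over any commutative ring, for a decomposition `V = W + W'` with `Ψ`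
scalar on `W` and preserving `W'`, and `g` preserving `W` and fixing `W'` pointwise, `Ψ ∘ g = g ∘ Ψ`;
(B) over `ℝ` with an inner product, self-adjointness of `Ψ` supplies the invariant complement `W' = Wᗮ`.
-/

namespace Summit.HodgeConjecture.HodgeConjecture.Theorems

section CommRing

variable {R V : Type*} [CommRing R] [AddCommGroup V] [Module R V]

/-- (A) If `V = W + W'`, `Ψ` acts on `W` by the scalar `c` and maps `W'` into itself, and `g` maps `W` into
itself and fixes `W'` pointwise, then `Ψ` and `g` commute. -/
theorem comp_eq_comp_of_scalar_on_of_invariant_compl (Ψ g : V →ₗ[R] V) (W W' : Submodule R V)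
    (hsup : W ⊔ W' = ⊤) (c : R) (hΨW : ∀ w ∈ W, Ψ w = c • w) (hΨW' : ∀ w ∈ W', Ψ w ∈ W')
    (hgW : ∀ w ∈ W, g w ∈ W) (hgW' : ∀ w ∈ W', g w = w) : Ψ ∘ₗ g = g ∘ₗ Ψ := by
  ext v
  have hv : v ∈ W ⊔ W' := by rw [hsup]; exact Submodule.mem_top
  obtain ⟨w, hw, w', hw', rfl⟩ := Submodule.mem_sup.mp hv
  simp only [LinearMap.comp_apply, map_add]
  rw [hgW' w' hw', hΨW w hw, map_smul, hΨW (g w) (hgW w hw), hgW' (Ψ w') (hΨW' w' hw')]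

end CommRing

section InnerProduct

variable {E : Type*} [NormedAddCommGroup E] [InnerProductSpace ℝ E] [FiniteDimensional ℝ E]

omit [FiniteDimensional ℝ E] in
/-- A symmetric endomorphism which is scalar on `W` maps `Wᗮ` into itself. -/
theorem mem_orthogonal_of_isSymmetric_of_scalar_on (Ψ : E →ₗ[ℝ] E) (W : Submodule ℝ E)
    (hΨ : Ψ.IsSymmetric) (c : ℝ) (hΨW : ∀ w ∈ W, Ψ w = c • w) {v : E} (hv : v ∈ Wᗮ) :
    Ψ v ∈ Wᗮ := by
  rw [Submodule.mem_orthogonal]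
  intro u hu
  rw [← hΨ u v, hΨW u hu, inner_smul_left, Submodule.inner_right_of_mem_orthogonal hu hv]
  simp

/-- (B) **Twistor invariance (Lemma 2.6.1, direction used).** A self-adjoint endomorphism `Ψ` of a
finite-dimensional real inner product space which acts on the subspace `W` by a scalar commutes with every
endomorphism `g` that preserves `W` and is the identity on `Wᗮ` (e.g. every rotation of `W` extended by the
identity). -/
theorem comp_eq_comp_of_isSymmetric_of_scalar_on (Ψ g : E →ₗ[ℝ] E) (W : Submodule ℝ E)
    (hΨ : Ψ.IsSymmetric) (c : ℝ) (hΨW : ∀ w ∈ W, Ψ w = c • w)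
    (hgW : ∀ w ∈ W, g w ∈ W) (hgW' : ∀ w ∈ Wᗮ, g w = w) : Ψ ∘ₗ g = g ∘ₗ Ψ := by
  exact comp_eq_comp_of_scalar_on_of_invariant_compl Ψ g W Wᗮ
    (Submodule.sup_orthogonal_of_hasOrthogonalProjection) c hΨW
    (fun w hw => mem_orthogonal_of_isSymmetric_of_scalar_on Ψ W hΨ c hΨW hw) hgW hgW'

/-- (C) A similarity of multiplier `d` conjugates an isometry to an isometry: if `⟪ψ x, ψ y⟫ = d ⟪x, y⟫`
with `d ≠ 0` and `g₁` preserves inner products, then so does `ψ ∘ g₁ ∘ ψ⁻¹` (here for a linear equivalence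
`ψ`).  This is why the diagonal twistor construction only needs conformality of `ψ` on the positive
3-plane. -/
theorem inner_conj_similarity {E₁ E₂ : Type*} [NormedAddCommGroup E₁] [InnerProductSpace ℝ E₁]
    [NormedAddCommGroup E₂] [InnerProductSpace ℝ E₂] (ψ : E₁ ≃ₗ[ℝ] E₂) (d : ℝ)
    (hψ : ∀ x y : E₁, inner ℝ (ψ x) (ψ y) = d * inner ℝ x y) (g₁ : E₁ →ₗ[ℝ] E₁)
    (hg₁ : ∀ x y : E₁, inner ℝ (g₁ x) (g₁ y) = inner ℝ x y) (x y : E₂) :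
    inner ℝ ((ψ.toLinearMap ∘ₗ g₁ ∘ₗ ψ.symm.toLinearMap) x)
      ((ψ.toLinearMap ∘ₗ g₁ ∘ₗ ψ.symm.toLinearMap) y) = inner ℝ x y := by
  simp only [LinearMap.comp_apply, LinearEquiv.coe_toLinearMap]
  rw [hψ, hg₁]
  have := hψ (ψ.symm x) (ψ.symm y)
  rw [LinearEquiv.apply_symm_apply, LinearEquiv.apply_symm_apply] at this
  rw [← this]

end InnerProduct

end Summit.HodgeConjecture.HodgeConjecture.Theorems
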